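import Literature.NumberTheory.EllipticCurves.SupersingularInertiaShapeProofs
import Literature.NumberTheory.GaloisRepresentations.PeuRamifieCriterionProofs
import HarnessLib

/-!
# `ρ̄_{E,p}` is *peu ramifié* at a good ordinary prime (Serre 1987, §2.8 Prop. 3 / §4.2) —
# the elliptic-curve half: the valuation of `σ x(P) - x(P)` for a `p`-torsion point `P`

`Proofs` file (theorems only: no definition, no named fact), topic `NumberTheory/EllipticCurves`;
sequel of `OrdinaryReductionTorsionLineProofs` (Serre's line `X_p`, the local good-reduction
setup) and of `GaloisRepresentations/PeuRamifieCriterionProofs` (the Galois-theoretic criterion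
`ModPGaloisRep.isPeuRamifie_of_forall_exists_algNorm_le`).

Serre, Duke 54 (1987), §2.8, Prop. 3: *"si `E` a bonne réduction ordinaire en `p`, … `ρ̄_p` est
peu ramifiée"*; the proof there ("`E_p` est fini et plat") is replaced by the following direct
computation on the good local model `MO / 𝒪_w` (`w` the spectral valuation of `K̄_v`), for `p`
odd:

* `eval_ne_zero_of_dominant_top_of_coeff_le_one`, `sq_mul_pow_le_one_of_eval_preΨ'_eq_zero` —
  **the `p`-torsion points of the kernel of reduction are not too deep**: an affine `p`-torsion
  point `T` with `|x_T| > 1` has `|p|² |x_T|^{p-1} ≤ 1` (the top term `p x^{(p²-1)/2}` of `ψ_p`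
  would otherwise dominate: the coefficients above degree `(p² - p)/2` are divisible by `p`,
  `natCast_dvd_coeff_preΨ'_prime`, all are integral);
* `valuation_natCast_le_pow_of_goodReductionHom_eq` — **the chord estimate**: for two distinct
  integral `p`-torsion points `A = (x, y)`, `A' = (x', y')` with the same reduction, the point
  `T = A' - A` lies in the kernel of reduction with `|x_T| = |x' - x|^{-2}` (the chord through
  `A'` and `-A` has slope `(y' + y + a₁ x + a₃)/(x' - x)` with unit numerator, `Ã` being of odd
  order), whence **`|p| ≤ |x' - x|^{p-1}`**.

* `spectralValuation_le_iff_algNorm_le` — the two absolute values of `K̄_v` (`|·|_v` and the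
  tree's `algNorm K_v`) define the same order;
* `WeierstrassCurve.isPeuRamifie_restrictField_of_not_dvd_frobeniusTraceAt` — **Serre 1987,
  §2.8 Prop. 3 / (4.2)**: for an elliptic curve `E` over a number field `K`, an odd prime `p`, a
  place `v ∣ p` of good ORDINARY reduction which is unramified over `p` (`p` is a uniformiser of
  `K_v`; e.g. `K = ℚ`), a framing `ρ̄` of `E[p]` and any `j : 𝔽_p → k` into a discrete field,
  the local representation `(ρ̄ ⊗_j k)|Γ_{K_v}` is *peu ramifiée*.  Assembly: the criterion
  `ModPGaloisRep.isPeuRamifie_of_forall_exists_algNorm_le` is fed with `#ρ̄(I_{K_v}) ≤ p(p-1)`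
  (the triangular form `IsTorsionGaloisRep.exists_conj_eq_of_line`) and, for `τ ∈ I_{K_v}` acting
  non-trivially, with `x = x(A)` for `A` the local avatar of a point `P ∈ E[p] ∖ X_p` moved by
  `res τ` (the chord estimate at `A` and `A' = A^τ`, which have the same reduction because inertia
  acts trivially on `Ẽ`, `goodReduction_reduction_line`).

## References

* [Serre1987] J.-P. Serre, Duke Math. J. 54 (1987), §2.4, §2.8 Prop. 3, §4.2.
* [SerreInventiones1972] J.-P. Serre, Invent. Math. 15 (1972), §1.11.
* [SilvermanAEC2009] J. H. Silverman, *The Arithmetic of Elliptic Curves*, 2nd ed. (2009),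
  III.2.3 (group law), Ex. 3.7 (`ψ_n`), VII.2.1–2.2, Thm. IV.6.1 / VII.3.4 (Newton polygon of
  `[p]`).
-/

noncomputable section

open scoped Classical NNReal
open Polynomial

universe u

namespace Literature.NumberTheory.EllipticCurves

open _root_.WeierstrassCurve

variable {L : Type u} [Field L] {w : Valuation L ℝ≥0}

/-! ## §1 The local estimates on `MO / 𝒪_w` -/

/-- **Two-term domination, integral version.**  Let `f = Σ cᵢ xⁱ` have degree `≤ n` over a valued
field with `|cᵢ| ≤ 1` for all `i`, `|cᵢ| ≤ π` for `i > n'` and `|c_n| = π > 0`, where `n' < n`.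
Then no `x` with `|x| > 1` and `π² |x|^{2(n - n')} > 1` is a root of `f`: the top term `c_n xⁿ`
strictly dominates (for `i ≤ n'`, `|cᵢ xⁱ| ≤ |x|^{n'} < π |x|ⁿ` as `π |x|^{n-n'} > 1`; for
`n' < i < n`, `|cᵢ xⁱ| ≤ π |x|ⁱ < π |x|ⁿ`).  Variant of `eval_ne_zero_of_dominant_top`
(`OrdinaryReductionTateModuleProofs`) without hypothesis on the constant term.
Silverman, *AEC*, Thm. IV.6.1 (proof). [cite: SilvermanAEC2009, Thm. IV.6.1 and Thm. VII.3.4(b)] -/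
theorem eval_ne_zero_of_dominant_top_of_coeff_le_one {f : L[X]} {n n' : ℕ} {π : ℝ≥0}
    (hdeg : f.natDegree ≤ n) (hall : ∀ i, w (f.coeff i) ≤ 1)
    (htop : ∀ i, n' < i → w (f.coeff i) ≤ π) (hn : w (f.coeff n) = π) (hπ0 : 0 < π)
    (hn'n : n' < n) {x : L} (hx1 : 1 < w x)
    (hdom : 1 < π ^ 2 * w x ^ (2 * (n - n'))) : f.eval x ≠ 0 := by
  set X := w x with hX
  have hX0 : 0 < X := zero_lt_one.trans hx1
  have hX1 : 1 ≤ X := hx1.le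
  -- `1 < π X^{n - n'}`
  have hkey : 1 < π * X ^ (n - n') := by
    by_contra hle
    rw [not_lt] at hle
    have h2 : (π * X ^ (n - n')) ^ 2 ≤ 1 := pow_le_one₀ zero_le hle
    rw [mul_pow, ← pow_mul, mul_comm (n - n') 2] at h2
    exact absurd (hdom.trans_le h2) (lt_irrefl _)
  -- every lower term is `< π Xⁿ`
  have hterm : ∀ i ∈ Finset.range n, w (f.coeff i * x ^ i) < π * X ^ n := by
    intro i hi
    rw [Finset.mem_range] at hi
    rw [map_mul, map_pow, ← hX]
    rcases le_or_gt i n' with hin' | hin'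
    · calc w (f.coeff i) * X ^ i ≤ 1 * X ^ n' := mul_le_mul' (hall i) (pow_le_pow_right₀ hX1 hin')
        _ = X ^ n' := one_mul _
        _ < π * X ^ (n - n') * X ^ n' := lt_mul_of_one_lt_left (pow_pos hX0 _) hkey
        _ = π * X ^ n := by rw [mul_assoc, ← pow_add, Nat.sub_add_cancel hn'n.le]
    · calc w (f.coeff i) * X ^ i ≤ π * X ^ i := by gcongr; exact htop i hin'
        _ < π * X ^ n := by gcongr
  -- hence `w (f x) = π Xⁿ ≠ 0`
  have hsum : f.eval x = f.coeff n * x ^ n + ∑ i ∈ Finset.range n, f.coeff i * x ^ i := by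
    rw [eval_eq_sum_range' (Nat.lt_succ_of_le hdeg), Finset.sum_range_succ, add_comm]
  have htopval : w (f.coeff n * x ^ n) = π * X ^ n := by rw [map_mul, map_pow, hn]
  have hne : π * X ^ n ≠ 0 := (mul_pos hπ0 (pow_pos hX0 n)).ne'
  have hlow : w (∑ i ∈ Finset.range n, f.coeff i * x ^ i) < w (f.coeff n * x ^ n) := by
    rw [htopval]
    exact Valuation.map_sum_lt _ hne hterm
  intro h0'
  rw [hsum] at h0'
  have := Valuation.map_add_eq_of_lt_left w hlow
  rw [h0', map_zero, htopval] at this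
  exact hne this.symm

/-- **The `p`-torsion of the kernel of reduction is not too deep.**  For a Weierstrass equation
`MO` over a valuation ring `𝒪 ⊆ L` and an odd prime `p` with `p ≠ 0` in `L`: a root `x` of
`ψ_p(MO)` with `|x| > 1` satisfies `|p|² |x|^{p-1} ≤ 1` (equivalently `v(x) ≥ -2v(p)/(p-1)`):
`ψ_p = p x^{(p²-1)/2} + ⋯` has integral coefficients, those above degree `(p² - p)/2` divisible
by `p` (`natCast_dvd_coeff_preΨ'_prime`, Silverman *AEC* Cor. IV.4.4), and
`2((p²-1)/2 - (p²-p)/2) = p - 1`.  Silverman, *AEC*, Thm. IV.6.1, VII.3.4(b) (slopes of the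
Newton polygon of `[p]`); Serre 1987, §2.8.
[cite: SilvermanAEC2009, Cor. IV.4.4, Thm. IV.6.1] [cite: Serre1987, §2.8 Prop. 3] -/
theorem sq_mul_pow_le_one_of_eval_preΨ'_eq_zero (O : ValuationSubring L) (hvO : w.Integers O)
    (MO : WeierstrassCurve O) (p : ℕ) [hp : Fact p.Prime] (hp2 : p ≠ 2) (hpL : (p : L) ≠ 0)
    {x : L} (hx1 : 1 < w x) (hroot : ((MO.baseChange L).preΨ' p).eval x = 0) :
    w (p : L) ^ 2 * w x ^ (p - 1) ≤ 1 := by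
  have hprime := hp.out
  obtain ⟨m, hm⟩ : ∃ m, p = 2 * m + 1 := hprime.odd_of_ne_two hp2
  have hm1 : 1 ≤ m := by have := hprime.two_le; omega
  obtain ⟨hn'0, hn'n, hnn'⟩ := half_sq_sub_aux hm hm1
  have hodd : ¬ Even p := Nat.not_even_iff_odd.mpr (hprime.odd_of_ne_two hp2)
  set f := (MO.baseChange L).preΨ' p with hfdef
  have hcoeff : ∀ i, f.coeff i = algebraMap O L ((MO.preΨ' p).coeff i) := by
    intro i
    rw [hfdef, baseChange, map_preΨ', Polynomial.coeff_map]
  have hdeg : f.natDegree ≤ (p ^ 2 - 1) / 2 := by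
    have := (MO.baseChange L).natDegree_preΨ'_le p
    rwa [if_neg hodd] at this
  have hall : ∀ i, w (f.coeff i) ≤ 1 := fun i ↦ by rw [hcoeff]; exact hvO.map_le_one _
  have htop : ∀ i, (p ^ 2 - p) / 2 < i → w (f.coeff i) ≤ w (p : L) := by
    intro i hi
    obtain ⟨c, hc⟩ := natCast_dvd_coeff_preΨ'_prime p hp2 MO hi
    rw [hcoeff, hc, map_mul, map_natCast, Valuation.map_mul]
    exact mul_le_of_le_one_right' (hvO.map_le_one c)
  have hcn : f.coeff ((p ^ 2 - 1) / 2) = (p : L) := by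
    have := (MO.baseChange L).coeff_preΨ' p
    rw [if_neg hodd, if_neg hodd] at this
    exact this
  have hwn : w (f.coeff ((p ^ 2 - 1) / 2)) = w (p : L) := by rw [hcn]
  have hπ0 : 0 < w (p : L) := (Valuation.pos_iff _).mpr hpL
  by_contra hlt
  rw [not_le] at hlt
  have hdom : 1 < w (p : L) ^ 2 * w x ^ (2 * ((p ^ 2 - 1) / 2 - (p ^ 2 - p) / 2)) := by
    rwa [hnn']
  exact eval_ne_zero_of_dominant_top_of_coeff_le_one hdeg hall htop hwn hπ0 hn'n hx1 hdom hroot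

/-- **The chord estimate `|p| ≤ |x' - x|^{p-1}`** (Serre 1987, §2.8, elliptic-curve side of
"ordinaire ⇒ peu ramifié").  Let `MO` be a Weierstrass equation with unit discriminant over a
valuation ring `𝒪 ⊆ L`, `p` an odd prime with `p ≠ 0` in `L`, and `A = (x, y)`, `A' = (x', y')`
two distinct `p`-torsion points of `MO(L)` with `A` integral (`|x| ≤ 1`) and the same reduction
`Ã' = Ã` (`goodReductionHom`, Silverman VII.2.1).  Then `|p| ≤ |x' - x|^{p-1}`.
Proof: `A'` is integral too and `x' ≡ x`, `y' ≡ y (mod 𝔪_w)`; `Ã ≠ Õ` has odd order `p`, so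
`2ȳ + ā₁x̄ + ā₃ ≠ 0` and `x' ≠ x` (else `A' = -A`, `2Ã = Õ`); the chord through `A'` and `-A` has
slope `λ = (y' + y + a₁x + a₃)/(x' - x)` of absolute value `|x' - x|⁻¹ > 1`, so `T = A' - A` has
`|x_T| = |λ² + a₁λ - a₂ - x' - x| = |x' - x|⁻²` (Silverman III.2.3) and is a `p`-torsion point of
the kernel of reduction; conclude by `sq_mul_pow_le_one_of_eval_preΨ'_eq_zero` (`ψ_p(x_T) = 0`,
Ex. 3.7).  [cite: Serre1987, §2.8 Prop. 3] [cite: SilvermanAEC2009, III.2.3, Ex. 3.7, VII.2.1] -/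
theorem valuation_natCast_le_pow_of_goodReductionHom_eq (O : ValuationSubring L)
    (hvO : w.Integers O) {MO : WeierstrassCurve O} (hΔO : IsUnit MO.Δ) (p : ℕ) [hp : Fact p.Prime]
    (hp2 : p ≠ 2) (hpL : (p : L) ≠ 0)
    {x y x' y' : L} {h : (MO.baseChange L).toAffine.Nonsingular x y}
    {h' : (MO.baseChange L).toAffine.Nonsingular x' y'} (hx : w x ≤ 1)
    (hred : goodReductionHom MO hvO hΔO (.some x' y' h') = goodReductionHom MO hvO hΔO (.some x y h))
    (hne : (.some x' y' h' : (MO.baseChange L).toAffine.Point) ≠ .some x y h)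
    (hpA : (p : ℤ) • (.some x y h : (MO.baseChange L).toAffine.Point) = 0)
    (hpA' : (p : ℤ) • (.some x' y' h' : (MO.baseChange L).toAffine.Point) = 0) :
    w (p : L) ≤ w (x' - x) ^ (p - 1) := by
  haveI hell : MO.IsElliptic := ⟨hΔO⟩
  haveI := isElliptic_map_residue (W := MO) hΔO
  have hinj := hvO.hom_inj
  set red := goodReductionHom MO hvO hΔO with hreddef
  obtain ⟨m, hm⟩ : ∃ m, p = 2 * m + 1 := hp.out.odd_of_ne_two hp2
  have hodd : ¬ Even p := Nat.not_even_iff_odd.mpr (hp.out.odd_of_ne_two hp2)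
  /- (1) `A = (x, y)` is integral, with affine reduction `(x̄, ȳ)` -/
  have hy : w y ≤ 1 := v_Y_le_one_of_v_X_le_one hvO h.1 hx
  obtain ⟨a, rfl⟩ := hvO.exists_of_le_one hx
  obtain ⟨b, rfl⟩ := hvO.exists_of_le_one hy
  have hnsA : (MO.map (IsLocalRing.residue O)).toAffine.Nonsingular (IsLocalRing.residue O a)
      (IsLocalRing.residue O b) :=
    (hasNonsingularReduction_some_algebraMap_iff hinj h).mp
      (hasNonsingularReduction_of_isUnit_Δ hvO hΔO _)
  have hredA : red (.some _ _ h) = .some _ _ hnsA := by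
    rw [hreddef, goodReductionHom_apply, reducePoint_some_algebraMap hinj h hnsA]
  /- (2) `A'` is integral as well (otherwise `Ã' = Õ ≠ Ã`), with the same affine reduction -/
  have hx' : w x' ≤ 1 := by
    by_contra hlt
    rw [not_le] at hlt
    have h0 : red (.some x' y' h') = 0 := by
      rw [hreddef, goodReductionHom_apply]
      exact reducePoint_some_of_not_mem h' ((not_mem_range_iff hvO).mpr hlt)
    rw [h0, hredA] at hred
    exact Affine.Point.some_ne_zero _ hred.symm
  have hy' : w y' ≤ 1 := v_Y_le_one_of_v_X_le_one hvO h'.1 hx'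
  obtain ⟨a', rfl⟩ := hvO.exists_of_le_one hx'
  obtain ⟨b', rfl⟩ := hvO.exists_of_le_one hy'
  have hnsA' : (MO.map (IsLocalRing.residue O)).toAffine.Nonsingular (IsLocalRing.residue O a')
      (IsLocalRing.residue O b') :=
    (hasNonsingularReduction_some_algebraMap_iff hinj h').mp
      (hasNonsingularReduction_of_isUnit_Δ hvO hΔO _)
  have hredA' : red (.some _ _ h') = .some _ _ hnsA' := by
    rw [hreddef, goodReductionHom_apply, reducePoint_some_algebraMap hinj h' hnsA']
  have hres : IsLocalRing.residue O a' = IsLocalRing.residue O a ∧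
      IsLocalRing.residue O b' = IsLocalRing.residue O b := by
    rw [hredA, hredA'] at hred
    exact (Affine.Point.some.injEq _ _ _ _ _ _).mp hred
  /- (3) `x' ≡ x`, `y' ≡ y (mod 𝔪_w)` -/
  have hval_lt : ∀ {c c' : O}, IsLocalRing.residue O c' = IsLocalRing.residue O c →
      w (algebraMap O L c' - algebraMap O L c) < 1 := by
    intro c c' hcc
    rw [← map_sub, v_algebraMap_lt_one_iff hvO, map_sub, hcc, sub_self]
  have hdx : w (algebraMap O L a' - algebraMap O L a) < 1 := hval_lt hres.1
  have hdy : w (algebraMap O L b' - algebraMap O L b) < 1 := hval_lt hres.2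
  /- (4) `Ã` has odd order: `2Ã ≠ Õ` -/
  have hpĀ : (p : ℤ) • red (.some _ _ h) = 0 := by rw [← map_zsmul, hpA, map_zero]
  have h2Ā : (2 : ℤ) • red (.some _ _ h) ≠ 0 := by
    intro h2
    have hmz : (p : ℤ) - (m : ℤ) * 2 = 1 := by
      have := congrArg (Nat.cast : ℕ → ℤ) hm
      push_cast at this
      omega
    have h0 : red (.some _ _ h) = 0 := by
      calc red (.some _ _ h) = ((p : ℤ) - (m : ℤ) * 2) • red (.some _ _ h) := by
            rw [hmz, one_smul]
        _ = (p : ℤ) • red (.some _ _ h) - (m : ℤ) • ((2 : ℤ) • red (.some _ _ h)) := by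
            rw [sub_smul, smul_smul]
        _ = 0 := by rw [hpĀ, h2, zsmul_zero, sub_zero]
    rw [hredA] at h0
    exact Affine.Point.some_ne_zero _ h0
  have hnegY : IsLocalRing.residue O b ≠
      (MO.map (IsLocalRing.residue O)).toAffine.negY (IsLocalRing.residue O a)
        (IsLocalRing.residue O b) := by
    intro hEq
    apply h2Ā
    have hneg : -(Affine.Point.some _ _ hnsA : (MO.map (IsLocalRing.residue O)).toAffine.Point) =
        .some _ _ hnsA := by
      rw [Affine.Point.neg_some]
      exact point_some_congr rfl hEq.symm
    rw [hredA, two_zsmul]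
    nth_rewrite 1 [← hneg]
    exact neg_add_cancel _
  /- (5) the unit `u = 2b + a₁ a + a₃` -/
  set u : O := 2 * b + MO.a₁ * a + MO.a₃ with hu
  have hures : IsLocalRing.residue O u ≠ 0 := by
    intro h0
    apply hnegY
    rw [hu, map_add, map_add, map_mul, map_mul, map_ofNat] at h0
    simp only [Affine.negY, map_a₁, map_a₃]
    linear_combination h0
  have hwu : w (algebraMap O L u) = 1 := by
    have hnot : ¬ w (algebraMap O L u) < 1 := fun hlt ↦
      hures ((v_algebraMap_lt_one_iff hvO u).mp hlt)
    exact le_antisymm (hvO.map_le_one u) (not_lt.mp hnot)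
  /- (6) `x' ≠ x` -/
  have hxne : algebraMap O L a' ≠ algebraMap O L a := by
    intro hxx
    rcases Affine.Y_eq_of_X_eq h'.1 h.1 hxx with hyy | hyy
    · exact hne (point_some_congr hxx hyy)
    · have hA'neg : (Affine.Point.some _ _ h' : (MO.baseChange L).toAffine.Point) =
          -(Affine.Point.some _ _ h) := by
        rw [Affine.Point.neg_some]; exact point_some_congr hxx hyy
      apply h2Ā
      rw [two_zsmul]
      nth_rewrite 1 [← hred]
      rw [hA'neg, map_neg, neg_add_cancel]
  /- (7) `T = A' - A` is an affine `p`-torsion point, so `ψ_p(x_T) = 0` -/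
  set ℓ := (MO.baseChange L).toAffine.slope (algebraMap O L a') (algebraMap O L a)
    (algebraMap O L b') ((MO.baseChange L).toAffine.negY (algebraMap O L a) (algebraMap O L b))
    with hℓ
  obtain ⟨xT, yT, hTns, hT, hxTdef⟩ : ∃ (xT yT : L)
      (hTns : (MO.baseChange L).toAffine.Nonsingular xT yT),
      (Affine.Point.some _ _ h' : (MO.baseChange L).toAffine.Point) - Affine.Point.some _ _ h =
        Affine.Point.some _ _ hTns ∧
      xT = (MO.baseChange L).toAffine.addX (algebraMap O L a') (algebraMap O L a) ℓ := by
    rw [sub_eq_add_neg, Affine.Point.neg_some, Affine.Point.add_of_X_ne hxne]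
    exact ⟨_, _, _, rfl, rfl⟩
  have hpT : (p : ℤ) • (Affine.Point.some _ _ hTns : (MO.baseChange L).toAffine.Point) = 0 := by
    rw [← hT, smul_sub, hpA, hpA', sub_zero]
  have hΨ : ((MO.baseChange L).ΨSq p).eval xT = 0 :=
    ((MO.baseChange L).zsmul_some_eq_zero_iff_eval_ΨSq hTns p).mp hpT
  have hroot : ((MO.baseChange L).preΨ' p).eval xT = 0 := by
    rw [(MO.baseChange L).ΨSq_ofNat p, if_neg hodd, mul_one, eval_pow] at hΨ
    exact pow_eq_zero_iff two_ne_zero |>.mp hΨ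
  /- (8) `|λ| |x' - x| = 1` and `|x_T| = |λ|²` -/
  have hℓ' : ℓ = (algebraMap O L b' -
      (MO.baseChange L).toAffine.negY (algebraMap O L a) (algebraMap O L b)) /
        (algebraMap O L a' - algebraMap O L a) := Affine.slope_of_X_ne hxne
  have hnum : algebraMap O L b' -
      (MO.baseChange L).toAffine.negY (algebraMap O L a) (algebraMap O L b) =
        algebraMap O L u + (algebraMap O L b' - algebraMap O L b) := by
    rw [hu]
    simp only [Affine.negY, baseChange, map_a₁, map_a₃, map_add, map_mul, map_ofNat]
    ring
  have hwnum : w (algebraMap O L b' -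
      (MO.baseChange L).toAffine.negY (algebraMap O L a) (algebraMap O L b)) = 1 := by
    rw [hnum, Valuation.map_add_eq_of_lt_left w (by rw [hwu]; exact hdy), hwu]
  set d := w (algebraMap O L a' - algebraMap O L a) with hd
  have hd0 : 0 < d := (Valuation.pos_iff _).mpr (sub_ne_zero.mpr hxne)
  have hwℓ : w ℓ * d = 1 := by
    rw [hℓ', map_div₀, hwnum, hd, div_mul_cancel₀ _ hd0.ne']
  have hℓ1 : 1 < w ℓ := by
    by_contra hle
    rw [not_lt] at hle
    have : w ℓ * d < 1 := by
      calc w ℓ * d ≤ 1 * d := by gcongr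
        _ = d := one_mul _
        _ < 1 := hdx
    rw [hwℓ] at this
    exact lt_irrefl _ this
  have hℓ2 : w ℓ < w ℓ ^ 2 := by
    calc w ℓ = w ℓ ^ 1 := (pow_one _).symm
      _ < w ℓ ^ 2 := pow_lt_pow_right₀ hℓ1 one_lt_two
  have h1ℓ2 : 1 < w ℓ ^ 2 := hℓ1.trans hℓ2
  have hxT' : xT = ℓ ^ 2 + ((MO.baseChange L).a₁ * ℓ - (MO.baseChange L).a₂ -
      algebraMap O L a' - algebraMap O L a) := by
    rw [hxTdef]
    simp only [Affine.addX]
    ring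
  have hxT : w xT = w ℓ ^ 2 := by
    rw [hxT']
    have hr : w ((MO.baseChange L).a₁ * ℓ - (MO.baseChange L).a₂ -
        algebraMap O L a' - algebraMap O L a) < w ℓ ^ 2 := by
      refine Valuation.map_sub_lt _ (Valuation.map_sub_lt _ (Valuation.map_sub_lt _ ?_ ?_) ?_) ?_
      · rw [Valuation.map_mul]
        calc w (MO.baseChange L).a₁ * w ℓ ≤ 1 * w ℓ := by
              gcongr
              simp only [baseChange, map_a₁]
              exact hvO.map_le_one _
          _ = w ℓ := one_mul _
          _ < w ℓ ^ 2 := hℓ2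
      · calc w (MO.baseChange L).a₂ ≤ 1 := by
              simp only [baseChange, map_a₂]
              exact hvO.map_le_one _
          _ < w ℓ ^ 2 := h1ℓ2
      · exact (hvO.map_le_one a').trans_lt h1ℓ2
      · exact (hvO.map_le_one a).trans_lt h1ℓ2
    rw [Valuation.map_add_eq_of_lt_left w (by rw [Valuation.map_pow]; exact hr), Valuation.map_pow]
  /- (9) `|p|² |x_T|^{p-1} ≤ 1`, i.e. `|p|² ≤ |x' - x|^{2(p-1)}` -/
  have hsq := sq_mul_pow_le_one_of_eval_preΨ'_eq_zero O hvO MO p hp2 hpL (x := xT)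
    (by rw [hxT]; exact h1ℓ2) hroot
  have hone : (w ℓ ^ 2) ^ (p - 1) * d ^ (2 * (p - 1)) = 1 := by
    rw [← pow_mul, ← mul_pow, hwℓ, one_pow]
  have hfin : w (p : L) ^ 2 ≤ (d ^ (p - 1)) ^ 2 := by
    calc w (p : L) ^ 2 = w (p : L) ^ 2 * ((w ℓ ^ 2) ^ (p - 1) * d ^ (2 * (p - 1))) := by
          rw [hone, mul_one]
      _ = (w (p : L) ^ 2 * w xT ^ (p - 1)) * d ^ (2 * (p - 1)) := by rw [hxT, mul_assoc]
      _ ≤ 1 * d ^ (2 * (p - 1)) := by gcongr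
      _ = (d ^ (p - 1)) ^ 2 := by rw [one_mul, ← pow_mul, mul_comm]
  exact le_of_pow_le_pow_left₀ two_ne_zero zero_le hfin

/-! ## §2 Assembly over a number field: `ρ̄_{E,p}|Γ_{K_v}` is peu ramifié -/

section NumberField

open _root_.WeierstrassCurve Literature.NumberTheory.GaloisRepresentations Field
  IsDedekindDomain IsDedekindDomain.HeightOneSpectrum NumberField ValuativeRel
  Literature.NumberTheory.GaloisRepresentations.IsNonarchimedeanLocalField
  Literature.NumberTheory.GaloisRepresentations.ModPGaloisRep
open scoped NumberField AddSubgroup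

/-- A square matrix fixing every vector is the identity. [folklore] -/
theorem matrix_eq_one_of_forall_mulVec_eq {R : Type*} [CommRing R] {n : ℕ}
    {M : Matrix (Fin n) (Fin n) R} (h : ∀ x : Fin n → R, M.mulVec x = x) : M = 1 := by
  ext i j
  have h1 := congrFun (h (Pi.single j 1)) i
  rw [Matrix.mulVec_single_one, Pi.single_apply] at h1
  rw [Matrix.one_apply]
  exact h1

/-- **Serre 1987, §2.8 Prop. 3: good ordinary reduction ⇒ `ρ̄_{E,p}` is *peu ramifié*.**  Let `E`
be an elliptic curve over a number field `K`, `p` an odd prime, `v ∣ p` a finite place of good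
ORDINARY reduction (`p ∤ a_v`) at which `p` is a uniformiser of `K_v` (`v` unramified over `p`,
e.g. `K = ℚ`), `ρ̄ : Γ_K → GL₂(𝔽_p)` a framing of `E[p]` and `j : 𝔽_p → k` a ring homomorphism
into a discrete field.  Then `(ρ̄ ⊗_j k)|Γ_{K_v}` is peu ramifiée: `ρ̄(I_{K_v}^u) = 1` for all
`u > 1` (Serre's `I_F^u`, upper numbering).
Proof (replacing Serre's "`E_p` est fini et plat"): by `isPeuRamifie_of_forall_exists_algNorm_le`
it suffices that `#ρ̄(I_{K_v}) ≤ p(p-1)` — the triangular form `(χ̄ *; 0 1)` of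
`IsTorsionGaloisRep.exists_conj_eq_of_line` — and that every `τ ∈ I_{K_v}` with `ρ̄(res τ) ≠ 1`
moves an integer `x` of `K̄_v` fixed by `ker ρ̄|Γ_{K_v}` with `|p| ≤ |τ x - x|^{p-1}`: take
`x = x(A)` where `A ∈ MO(K̄_v)` is the local avatar of a point `P ∈ E[p]` outside the kernel of
reduction and moved by `res τ`; `A` and `A' = A^τ` are distinct integral `p`-torsion points with
the same reduction (inertia acts trivially on `Ẽ`), and the chord estimate
`valuation_natCast_le_pow_of_goodReductionHom_eq` applies.
[cite: Serre1987, §2.8 Prop. 3, §2.4, §4.2] [cite: SerreInventiones1972, §1.11] -/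
theorem _root_.WeierstrassCurve.isPeuRamifie_restrictField_of_not_dvd_frobeniusTraceAt
    {K : Type} [Field K] [NumberField K]
    (W : WeierstrassCurve K) [W.IsElliptic] (p : ℕ) [hp : Fact p.Prime] (hp2 : p ≠ 2)
    (v : HeightOneSpectrum (𝓞 K)) (hpv : (p : 𝓞 K) ∈ v.asIdeal) (hgood : W.HasGoodReductionAt v)
    (hord : ¬ ((p : ℤ) ∣ W.frobeniusTraceAt v))
    (hirr : Irreducible ((p : ℕ) : 𝒪[v.adicCompletion K]))
    {ρ : ModPGaloisRep K (ZMod p) 2} (hρ : W.IsTorsionGaloisRep p ρ)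
    {k : Type} [Field k] [TopologicalSpace k] [DiscreteTopology k] (j : ZMod p →+* k)
    (hj : Continuous j) :
    ModPGaloisRep.IsPeuRamifie
      (FramedGaloisRep.restrictField (v.adicCompletion K) (FramedRep.baseChange j hj ρ) :
        ModPGaloisRep (v.adicCompletion K) k 2) := by
  haveI : CharZero (v.adicCompletion K) :=
    charZero_of_injective_algebraMap (algebraMap K (v.adicCompletion K)).injective
  haveI : CharZero (AlgebraicClosure (v.adicCompletion K)) :=
    charZero_of_injective_algebraMap
      (algebraMap (v.adicCompletion K) (AlgebraicClosure (v.adicCompletion K))).injective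
  /- Step A: it suffices to treat `ρ̄|Γ_{K_v}` itself (`j (1) = 1`). -/
  suffices hF : ModPGaloisRep.IsPeuRamifie (FramedGaloisRep.restrictField (v.adicCompletion K) ρ :
      ModPGaloisRep (v.adicCompletion K) (ZMod p) 2) by
    intro u hu σ hσ
    have h1 : ρ (absGaloisRestrict K (v.adicCompletion K) σ) = 1 := hF u hu σ hσ
    apply Units.ext
    rw [FramedGaloisRep.restrictField_apply, FramedRep.coe_baseChange_apply, h1, Units.val_one,
      Units.val_one, Matrix.map_one j (map_zero j) (map_one j)]
  /- Step B: the residue characteristic of `K_v` is `p`. -/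
  have hpF : ringChar 𝓀[v.adicCompletion K] = p := by
    have hmem : ((p : ℕ) : 𝒪[v.adicCompletion K]) ∈ 𝓂[v.adicCompletion K] :=
      (IsLocalRing.mem_maximalIdeal _).mpr hirr.not_isUnit
    have h0 : ((p : ℕ) : 𝓀[v.adicCompletion K]) = 0 := by
      rw [← map_natCast (IsLocalRing.residue 𝒪[v.adicCompletion K]),
        IsLocalRing.residue_eq_zero_iff]
      exact hmem
    have hdvd : ringChar 𝓀[v.adicCompletion K] ∣ p := (ringChar.spec _ p).mp h0
    exact (Nat.prime_dvd_prime_iff_eq (ringChar_residueField_prime (F := v.adicCompletion K))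
      hp.out).mp hdvd
  /- the framing and the line -/
  obtain ⟨e, he⟩ := id hρ
  have hρres : ∀ τ : absoluteGaloisGroup (v.adicCompletion K),
      (FramedGaloisRep.restrictField (v.adicCompletion K) ρ :
        ModPGaloisRep (v.adicCompletion K) (ZMod p) 2) τ =
        ρ (absGaloisRestrict K (v.adicCompletion K) τ) := fun τ ↦ rfl
  refine ModPGaloisRep.isPeuRamifie_of_forall_exists_algNorm_le _ hpF hirr ?_ ?_
  · /- Step C: `#ρ̄(I_{K_v}) ≤ p (p - 1)` from the triangular form `(det *; 0 1)`. -/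
    obtain ⟨Λ, hΛ, hcardΛ, hstabΛ, hquot⟩ :=
      exists_line_geomTorsion_of_not_dvd_frobeniusTraceAt W p v hpv hgood hord
    obtain ⟨Q, hQ⟩ := IsTorsionGaloisRep.exists_conj_eq_of_line hρ hΛ hcardΛ
      (fun τ hτ x hx ↦ hstabΛ τ x hx) hquot
    let ψ : ↥((absInertia (v.adicCompletion K)).map
        (FramedGaloisRep.restrictField (v.adicCompletion K) ρ :
          ModPGaloisRep (v.adicCompletion K) (ZMod p) 2).toMonoidHom) → (ZMod p)ˣ × ZMod p :=
      fun g ↦ (Matrix.GeneralLinearGroup.det g.1,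
        ((Q⁻¹ * g.1 * Q : GL (Fin 2) (ZMod p)) : Matrix (Fin 2) (Fin 2) (ZMod p)) 0 1)
    have hψ : Function.Injective ψ := by
      rintro ⟨g, hg⟩ ⟨g', hg'⟩ hgg'
      obtain ⟨τ, hτ, rfl⟩ := Subgroup.mem_map.mp hg
      obtain ⟨τ', hτ', rfl⟩ := Subgroup.mem_map.mp hg'
      obtain ⟨c, hc⟩ := hQ τ hτ
      obtain ⟨c', hc'⟩ := hQ τ' hτ'
      simp only [ψ, Prod.mk.injEq] at hgg'
      obtain ⟨hdet, h01⟩ := hgg'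
      change Matrix.GeneralLinearGroup.det (ρ (absGaloisRestrict K (v.adicCompletion K) τ)) =
        Matrix.GeneralLinearGroup.det (ρ (absGaloisRestrict K (v.adicCompletion K) τ')) at hdet
      change ((Q⁻¹ * ρ (absGaloisRestrict K (v.adicCompletion K) τ) * Q : GL (Fin 2) (ZMod p)) :
          Matrix (Fin 2) (Fin 2) (ZMod p)) 0 1 =
        ((Q⁻¹ * ρ (absGaloisRestrict K (v.adicCompletion K) τ') * Q : GL (Fin 2) (ZMod p)) :
          Matrix (Fin 2) (Fin 2) (ZMod p)) 0 1 at h01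
      rw [hc, hc'] at h01
      have hcc : c = c' := by simpa using h01
      have hM : (Q⁻¹ * ρ (absGaloisRestrict K (v.adicCompletion K) τ) * Q : GL (Fin 2) (ZMod p)) =
          Q⁻¹ * ρ (absGaloisRestrict K (v.adicCompletion K) τ') * Q := by
        apply Units.ext
        rw [hc, hc', hdet, hcc]
      apply Subtype.ext
      change ρ (absGaloisRestrict K (v.adicCompletion K) τ) =
        ρ (absGaloisRestrict K (v.adicCompletion K) τ')
      have := congrArg (fun M : GL (Fin 2) (ZMod p) ↦ Q * M * Q⁻¹) hM
      simpa [mul_assoc] using this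
    calc Nat.card _ ≤ Nat.card ((ZMod p)ˣ × ZMod p) := Nat.card_le_card_of_injective ψ hψ
      _ = p * (p - 1) := by
        rw [Nat.card_prod, Nat.card_zmod, Nat.card_eq_fintype_card, ZMod.card_units_eq_totient,
          Nat.totient_prime hp.out, mul_comm]
  · /- Step D: the valuation witnesses. -/
    intro τ hτ hτ1
    rw [hρres] at hτ1
    set g := absGaloisRestrict K (v.adicCompletion K) τ with hgdef
    obtain ⟨w, hw, φ, Φ₀, hX, _, hΔO, hΦ₀⟩ := exists_goodReduction_localModel W v hgood
    have hvO : w.Integers w.valuationSubring := Valuation.valuationSubring.integers w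
    set red := goodReductionHom ((W.localMinimalIntegralModel v).map φ) hvO hΔO with hreddef
    set f : geomPoints W →+ (((W.localMinimalIntegralModel v).map φ).map
        (IsLocalRing.residue w.valuationSubring)).toAffine.Point :=
      red.comp (((Φ₀.trans (Affine.Point.congrEquiv hX)).toAddMonoidHom).comp
        (pointsMap W (v.adicCompletion K))) with hfdef
    have hf : ∀ a, f a =
        red (Affine.Point.congrEquiv hX (Φ₀ (pointsMap W (v.adicCompletion K) a))) :=
      fun a ↦ rfl
    obtain ⟨hstab, hinv, hcardf⟩ := goodReduction_reduction_line W p v hpv hgood hord hw hΔO hX Φ₀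
      hΦ₀ f hf
    -- `#E[p] = p²`
    have hp0 : p ≠ 0 := hp.out.ne_zero
    have hA : Nat.card (geomTorsion W p) = p ^ 2 :=
      card_torsionBy_eq_sq (E := W.baseChange (AlgebraicClosure K)) (n := p) (by exact_mod_cast hp0)
    -- (i) some torsion point is moved by `g`
    have hmoved₁ : ∃ X : geomTorsion W p, g • X ≠ X := by
      by_contra hno
      push Not at hno
      apply hτ1
      apply Units.ext
      refine matrix_eq_one_of_forall_mulVec_eq fun x ↦ ?_
      have := he g (e.symm x)
      rw [hno, AddEquiv.apply_symm_apply] at this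
      exact this.symm
    -- (ii) some torsion point outside `ker f`
    have hout : ∃ X : geomTorsion W p, f X ≠ 0 := by
      by_contra hno
      push Not at hno
      have hle : geomTorsion W p ≤ f.ker := fun x hx ↦ (AddMonoidHom.mem_ker).mpr (hno ⟨x, hx⟩)
      have heq : f.ker ⊓ geomTorsion W p = geomTorsion W p := inf_eq_right.mpr hle
      rw [heq, hA] at hcardf
      have h1 := hp.out.one_lt
      have : p ^ 2 = p * p := sq p
      rw [this] at hcardf
      exact absurd hcardf (by nlinarith)
    -- (iii) a torsion point outside `ker f` moved by `g`
    obtain ⟨P, hPt, hfP, hgP⟩ :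
        ∃ P : geomPoints W, P ∈ geomTorsion W p ∧ f P ≠ 0 ∧ g • P ≠ P := by
      obtain ⟨X₁, hX₁⟩ := hmoved₁
      have hgX₁ : g • (X₁ : geomPoints W) ≠ X₁ := fun h ↦ hX₁ (Subtype.ext (by
        rw [AddSubgroup.torsionBy.coe_smul]; exact h))
      by_cases hf₁ : f X₁ ≠ 0
      · exact ⟨X₁, X₁.2, hf₁, hgX₁⟩
      rw [not_ne_iff] at hf₁
      obtain ⟨X₂, hX₂⟩ := hout
      by_cases hg₂ : g • (X₂ : geomPoints W) = X₂
      · refine ⟨X₁ + X₂, add_mem X₁.2 X₂.2, ?_, ?_⟩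
        · rw [map_add, hf₁, zero_add]; exact hX₂
        · rw [smul_add, hg₂]
          exact fun h ↦ hgX₁ (add_right_cancel h)
      · exact ⟨X₂, X₂.2, hX₂, hg₂⟩
    have hgPt : g • P ∈ geomTorsion W p := by
      rw [mem_torsionBy_iff] at hPt ⊢
      rw [smul_comm (p : ℤ), hPt, smul_zero]
    -- the local avatars `A = Φ (pointsMap P)`, `A' = Φ (pointsMap (g • P))`
    let σE : AlgebraicClosure (v.adicCompletion K) →ₐ[v.adicCompletion K]
        AlgebraicClosure (v.adicCompletion K) :=
      ((absoluteGaloisGroup.toAlgEquiv (v.adicCompletion K) τ :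
          AlgebraicClosure (v.adicCompletion K) ≃ₐ[v.adicCompletion K]
            AlgebraicClosure (v.adicCompletion K)) :
        AlgebraicClosure (v.adicCompletion K) →ₐ[v.adicCompletion K]
          AlgebraicClosure (v.adicCompletion K))
    have hσE : ∀ z, σE z = τ • z := fun z ↦ rfl
    have hmap : ∀ a : geomPoints W, Φ₀ (pointsMap W (v.adicCompletion K)
        (absGaloisRestrict K (v.adicCompletion K) τ • a)) =
          Affine.Point.map σE (Φ₀ (pointsMap W (v.adicCompletion K) a)) := by
      intro a
      rw [← resGal_eq_absGaloisRestrict, pointsMap_smul, hΦ₀]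
    -- case analysis on the `X`-level point `B = Φ₀ (pointsMap P)`
    set B := Φ₀ (pointsMap W (v.adicCompletion K) P) with hBdef
    rcases hB : B with _ | ⟨x, y, hxy⟩
    · -- `B = O`: then `f P = 0`
      exfalso
      apply hfP
      rw [hf, ← hBdef, hB, ← Affine.Point.zero_def, map_zero, map_zero]
    -- `A = (x, y)` on `MO`, `A' = (τ x, τ y)`
    have hAeq : Affine.Point.congrEquiv hX B = .some x y (hX ▸ hxy) := by
      rw [hB, Affine.Point.congrEquiv_some]
    have hA'eq : Affine.Point.congrEquiv hX (Affine.Point.map σE B) =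
        .some (σE x) (σE y) (hX ▸ ((WeierstrassCurve.Affine.baseChange_nonsingular _ σE.injective ..).mpr hxy)) := by
      rw [hB, Affine.Point.map_some, Affine.Point.congrEquiv_some]
    -- `A` is integral (`f P ≠ 0`)
    have hx1 : w x ≤ 1 := by
      by_contra hlt
      rw [not_le] at hlt
      apply hfP
      rw [hf, ← hBdef, hAeq, hreddef, goodReductionHom_apply]
      exact reducePoint_some_of_not_mem _ ((not_mem_range_iff hvO).mpr hlt)
    -- the chord estimate
    have hest : w ((p : ℕ) : AlgebraicClosure (v.adicCompletion K)) ≤ w (σE x - x) ^ (p - 1) := by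
      have hpL : ((p : ℕ) : AlgebraicClosure (v.adicCompletion K)) ≠ 0 :=
        Nat.cast_ne_zero.mpr hp0
      -- same reduction: `f (g • P) = f P`
      have hred' : goodReductionHom ((W.localMinimalIntegralModel v).map φ) hvO hΔO
          (Affine.Point.congrEquiv hX (Affine.Point.map σE B)) =
          goodReductionHom ((W.localMinimalIntegralModel v).map φ) hvO hΔO
            (Affine.Point.congrEquiv hX B) := by
        have := hinv τ hτ P
        rwa [hf, hf, hmap, ← hBdef] at this
      rw [hA'eq, hAeq] at hred'
      -- distinct: `g • P ≠ P`
      have hne' : Affine.Point.congrEquiv hX (Affine.Point.map σE B) ≠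
          Affine.Point.congrEquiv hX B := by
        intro hEq
        apply hgP
        have h1 : Affine.Point.congrEquiv hX (Φ₀ (pointsMap W (v.adicCompletion K) (g • P))) =
            Affine.Point.congrEquiv hX (Φ₀ (pointsMap W (v.adicCompletion K) P)) := by
          rw [hgdef, hmap, ← hBdef]; exact hEq
        exact pointsMapOfEmb_injective W (closureEmb (K := K) (v.adicCompletion K))
          (Φ₀.injective ((Affine.Point.congrEquiv hX).injective h1))
      rw [hA'eq, hAeq] at hne'
      -- `p • A = 0`, `p • A' = 0`
      have hpA : (p : ℤ) • Affine.Point.congrEquiv hX B = 0 := by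
        rw [hBdef, ← map_zsmul, ← map_zsmul, ← map_zsmul, mem_torsionBy_iff.mp hPt, map_zero,
          map_zero, map_zero]
      rw [hAeq] at hpA
      have hpA' : (p : ℤ) • Affine.Point.congrEquiv hX (Affine.Point.map σE B) = 0 := by
        rw [hBdef, ← hmap, ← hgdef, ← map_zsmul, ← map_zsmul, ← map_zsmul,
          mem_torsionBy_iff.mp hgPt, map_zero, map_zero, map_zero]
      rw [hA'eq] at hpA'
      exact valuation_natCast_le_pow_of_goodReductionHom_eq w.valuationSubring hvO hΔO p hp2 hpL hx1
        hred' hne' hpA hpA'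
    -- the witness `x`
    refine ⟨x, ?_, ?_, ?_⟩
    · -- fixed by `ker ρ̄|Γ_{K_v}`
      intro σ hσ
      rw [hρres] at hσ
      have hfix : absGaloisRestrict K (v.adicCompletion K) σ • P = P := by
        have h1 := he (absGaloisRestrict K (v.adicCompletion K) σ) ⟨P, hPt⟩
        rw [hσ, Units.val_one, Matrix.one_mulVec] at h1
        have h2 := e.injective h1
        exact congrArg Subtype.val h2
      have h3 := congrArg Φ₀ (congrArg (pointsMap W (v.adicCompletion K)) hfix)
      rw [← resGal_eq_absGaloisRestrict, pointsMap_smul, hΦ₀, ← hBdef, hB, Affine.Point.map_some]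
        at h3
      exact ((Affine.Point.some.injEq _ _ _ _ _ _).mp h3).1
    · -- integral
      exact (spectralValuation_le_one_iff_algNorm_le_one hw x).mp hx1
    · -- `|p| ≤ |τ x - x|^{p-1}`
      rw [map_natCast, ← algNorm_pow, ← spectralValuation_le_iff_algNorm_le hw, Valuation.map_pow,
        ← hσE]
      exact hest

end NumberField

end Literature.NumberTheory.EllipticCurves
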